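import Summits.HodgeConjecture.HodgeConjecture.Theorems.AnchorTransportVariationalHodgePadicGrothendieckExistenceVectorBundlesWitt
import Summits.HodgeConjecture.HodgeConjecture.Theorems.AnchorTransportVariationalHodgePadicEffectiveProClasses

/-!
# STUB P on effective pro-classes over ALL proper models — unconditionally

Row b03 / crux `AnchorTransport.VariationalHodge` (stmt-HodgeConjecture-1076), line padic-disc-transport,
STUB P. `…AnchorTransportVariationalHodgePadicEffectiveProClasses` proved the rung "STUB P holds for
EFFECTIVE pro-classes on proper `𝒴 / W(κ)`" MODULO the Literature named fact
`Motives.GrothendieckExistence_vectorBundle_witt` (hypothesis `hGE`; Görtz–Wedhorn II Thm. 24.94 /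
Prop. 24.95 = EGA III₁ 5.1.4). That fact is now the theorem
`GrothendieckExistenceProper.GrothendieckExistence_vectorBundle_witt_holds`
(`…GrothendieckExistenceVectorBundlesWitt`), so the rungs hold outright, for every PROPER model (no
smoothness or projectivity):

* `of_mem_range_map_specialFibreι_of_liftsFormally_of_isProper` — a formally lifting bundle on the
  special fibre has algebraic `K₀`-class;
* `proClassAlgebraizes_of_tower_of_isProper`, `proClassAlgebraizes_of_mem_span_effective_of_isProper`
  — STUB P's conclusion for pro-classes with effective (resp. `ℚ`-span-of-effective) bottom class;
* `padicImageAlgebraization_effective` — the bet's quantifier block with the one extra binder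
  "`ξ̂|_{X_0}` effective", `p₀ = 0`.

What remains open of STUB P is exactly the non-effective pro-classes (AMMN Conj. 1.3 / BEK Conj. 1.2).

HONEST FRAMING: research route conditional on HC_CM; not a corollary; Q11.4-sentence-2 already
refuted in dim ≥ 3. Nothing here bears on `HC_CM`; no case of the Hodge conjecture is proved.

References: GortzWedhorn2023 (II: Thm. 24.94, Prop. 24.95); EGAIII1 (Thm. 5.1.4);
BlochEsnaultKerz2014pAdic (§1 (1.3), Conj. 1.2); AntieauMathewMorrowNikolaus2022 (Conj. 1.3).
-/

set_option linter.dupNamespace false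

noncomputable section

-- Summit.HodgeConjecture.HodgeConjecture.… repeats the summit name by the D-0017 layout (Sub = Summit).

-- `TopCat.Presheaf`/`Scheme.Modules` are not reducible (as in Mathlib's `AlgebraicGeometry/Modules`).
set_option backward.isDefEq.respectTransparency false

open CategoryTheory CategoryTheory.Limits AlgebraicGeometry
open scoped TensorProduct
open Literature.AlgebraicGeometry Literature.AlgebraicGeometry.Motives
open Literature.AlgebraicGeometry.KTheory Literature.AlgebraicGeometry.Crystalline

namespace Summit.HodgeConjecture.HodgeConjecture.Theorems

variable {p : ℕ} [Fact p.Prime] {κ : Type} [Field κ] [CharP κ p] [PerfectRing κ p]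
  (𝒴 : SchemeOver (WittVector p κ))

/-- **On a proper `𝒴 / W(κ)` a formally lifting bundle on the special fibre has algebraic class**:
`[E₁]_ℚ ∈ im(K₀(𝒴)_ℚ → K₀(Y_κ)_ℚ)` (Grothendieck's existence theorem, now proved). -/
theorem of_mem_range_map_specialFibreι_of_liftsFormally_of_isProper (h𝒴 : IsProper 𝒴.hom)
    {E₁ : (WittScheme.specialFibre 𝒴).left.Modules} (hE₁ : IsFiniteLocallyFree E₁)
    (h : WittScheme.LiftsFormally 𝒴 E₁) :
    KZeroRat.of E₁ hE₁ ∈ LinearMap.range (KZeroRat.map (WittScheme.specialFibreι 𝒴)) :=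
  of_mem_range_map_specialFibreι_of_liftsFormally_of_grothendieckExistence 𝒴
    GrothendieckExistenceProper.GrothendieckExistence_vectorBundle_witt_holds h𝒴 hE₁ h

/-- **THE RUNG, unconditionally — STUB P holds on effective pro-classes over every PROPER
`𝒴 / W(κ)`**: if the bottom class of the rational pro-class `ξ̂` is the class of the bottom bundle of
a compatible tower of vector bundles on the thickenings, then `ξ̂|_{Y_κ}` is the restriction of an
algebraic class `η ∈ K₀(𝒴)_ℚ`. -/
theorem proClassAlgebraizes_of_tower_of_isProper (h𝒴 : IsProper 𝒴.hom)
    (E : ∀ n : ℕ, (KTheory.thickening (Ideal.span {(p : WittVector p κ)}) 𝒴 n).Modules)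
    (hE : ∀ n, IsFiniteLocallyFree (E n))
    (hc : ∀ n, Nonempty ((Scheme.Modules.pullback
      (thickeningTransition (Ideal.span {(p : WittVector p κ)}) 𝒴 n)).obj (E (n + 1)) ≅ E n))
    (ξ : ContinuousKZeroRat (Ideal.span {(p : WittVector p κ)}) 𝒴)
    (hξ : ContinuousKZeroRat.specialFibre (Ideal.span {(p : WittVector p κ)}) 𝒴 ξ =
      KZeroRat.of (E 0) (hE 0)) :
    ∃ η : KZeroRat 𝒴.left,
        KZeroRat.map (WittScheme.specialFibreι 𝒴) η =
          KZeroRat.map (specialFibreToTower 𝒴)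
            (ContinuousKZeroRat.specialFibre (Ideal.span {(p : WittVector p κ)}) 𝒴 ξ) :=
  proClassAlgebraizes_of_tower_of_grothendieckExistence 𝒴
    GrothendieckExistenceProper.GrothendieckExistence_vectorBundle_witt_holds h𝒴 E hE hc ξ hξ

/-- **`ℚ`-span form, unconditionally**: STUB P holds over every proper `𝒴 / W(κ)` for every rational
pro-class whose bottom class lies in the `ℚ`-span of bottom classes of compatible towers of vector
bundles. -/
theorem proClassAlgebraizes_of_mem_span_effective_of_isProper (h𝒴 : IsProper 𝒴.hom)
    (ξ : ContinuousKZeroRat (Ideal.span {(p : WittVector p κ)}) 𝒴)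
    (hξ : ContinuousKZeroRat.specialFibre (Ideal.span {(p : WittVector p κ)}) 𝒴 ξ ∈
      Submodule.span ℚ
        {c : KZeroRat (KTheory.thickening (Ideal.span {(p : WittVector p κ)}) 𝒴 0) |
          ∃ (E : ∀ n : ℕ, (KTheory.thickening (Ideal.span {(p : WittVector p κ)}) 𝒴 n).Modules)
            (hE : ∀ n, IsFiniteLocallyFree (E n)),
            (∀ n, Nonempty ((Scheme.Modules.pullback
              (thickeningTransition (Ideal.span {(p : WittVector p κ)}) 𝒴 n)).obj (E (n + 1)) ≅
                E n)) ∧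
            c = KZeroRat.of (E 0) (hE 0)}) :
    ∃ η : KZeroRat 𝒴.left,
        KZeroRat.map (WittScheme.specialFibreι 𝒴) η =
          KZeroRat.map (specialFibreToTower 𝒴)
            (ContinuousKZeroRat.specialFibre (Ideal.span {(p : WittVector p κ)}) 𝒴 ξ) :=
  proClassAlgebraizes_of_mem_span_effective_of_grothendieckExistence 𝒴
    GrothendieckExistenceProper.GrothendieckExistence_vectorBundle_witt_holds h𝒴 ξ hξ

/-- **STUB P with the ONE extra binder "`ξ̂|_{X_0}` effective" — unconditionally** (the bet's
quantifier block verbatim, `p₀ = 0`; only properness of the model is used). -/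
theorem padicImageAlgebraization_effective :
    ∀ d : ℕ, ∃ p₀ : ℕ, ∀ (p : ℕ) [Fact p.Prime], p₀ ≤ p →
    ∀ (κ : Type) [Field κ] [CharP κ p] [PerfectRing κ p] [IsAlgClosed κ] [Algebra (ZMod p) κ],
    Algebra.IsAlgebraic (ZMod p) κ →
    ∀ (𝒴 : SchemeOver (WittVector p κ)), WittScheme.IsSmoothProperModel d 𝒴 →
    ∀ ξ : ContinuousKZeroRat (Ideal.span {(p : WittVector p κ)}) 𝒴,
    (∃ (E : ∀ n : ℕ, (KTheory.thickening (Ideal.span {(p : WittVector p κ)}) 𝒴 n).Modules)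
        (hE : ∀ n, IsFiniteLocallyFree (E n)),
        (∀ n, Nonempty ((Scheme.Modules.pullback
          (thickeningTransition (Ideal.span {(p : WittVector p κ)}) 𝒴 n)).obj (E (n + 1)) ≅ E n)) ∧
        ContinuousKZeroRat.specialFibre (Ideal.span {(p : WittVector p κ)}) 𝒴 ξ =
          KZeroRat.of (E 0) (hE 0)) →
    ∃ η : KZeroRat 𝒴.left,
      KZeroRat.map (WittScheme.specialFibreι 𝒴) η =
        KZeroRat.map (specialFibreToTower 𝒴)
          (ContinuousKZeroRat.specialFibre (Ideal.span {(p : WittVector p κ)}) 𝒴 ξ) :=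
  padicImageAlgebraization_effective_of_grothendieckExistence
    GrothendieckExistenceProper.GrothendieckExistence_vectorBundle_witt_holds

end Summit.HodgeConjecture.HodgeConjecture.Theorems

end
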